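import Summits.QuantumFields.YangMills.Theorems.UnitScaleTiltFluctuationComparisonRegPrGlobalSlackKernelLegResidualSplit
import Summits.QuantumFields.YangMills.Theorems.UnitScaleTiltFluctuationComparisonRegPrGlobalSlackStepFarTheta
import HarnessLib

/-!
# `UnitScaleTiltFluctuationComparisonRegPrGlobalSlackKernelLegResidualFar` — THE BIRTH FAR ROW OF (R3): THE STEP-CHART HALF IS A THEOREM (G3D-06, ★w3's `abs_stepFar_le_theta7`),
# THE (61)-BORN HALF IS THE ONE DISPLAY LEFT (crux `FluctuationComparisonRegPrIntL`, stmt-QuantumFields-20520, skeleton v5kC, STUB 3⁗χ; width seat ym-ust-20520-w1 g0, count-neutral)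

WHY.  `…KernelLegResidualSplit` (p585906) reduces 3⁗χ's seventh-order residual row (R3), per run, to `NewLevelIsBirth ∧ OldTermsAreJetsOwn ∧ BirthFarSmallOwn q b₀ p₀ κ C_F` — the last being
«`|far_X(triv,W) + far^Λ_X(triv,W)| ≤ C_F·e^{−κ·dj X}·θ(K−k−1)⁷` for every retained step-`k` domain `X` of run `K` and every field `W`».  The STEP-CHART far terms satisfy this from the
displayed G3D-06 row alone (★ym-ust-20520-w3 g0, `abs_stepFar_le_theta7`, p585502: the spare coupling of the (25)-amplitude absorbs the collar polylogarithm, and one height is traded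
for `((√L)⁻¹(1+log √L)^{p₀})⁷`).  The (61)-BORN far terms do not (g-free amplitude `C63`, `…KernelLegBirth` located item (b)).  This file isolates exactly that remainder:

* §1 **`LambdaFarSmallOwn q b₀ p₀ κ C_Λ`** (hypothesis schema, ONE run, never asserted): `|far^Λ_X(triv, W)| ≤ C_Λ·e^{−κ·dj X}·θ(K−k−1)⁷` — the print-faithful re-display of G3D-07's far
  row (the far monomials are `O(e^{−R₁r(g_k)})`, [Balaban1985UV3] p.262 L25–27 «smaller than arbitrary power of ε»), i.e. what a spare `g_k` in its amplitude would give;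
* §2 `stepFarConst 𝔠` (★w3's constant) and **`birthFarSmallOwn_of_lambda`**: `LambdaFarSmallOwn q 𝔠.b₀ 𝔠.p₀ 𝔠.κ C_Λ → BirthFarSmallOwn q 𝔠.b₀ 𝔠.p₀ 𝔠.κ (stepFarConst 𝔠 + C_Λ)`;
* §3 **`remainderSmallOwnΦ_of_jets_lambda`** / `…_chi_…`: (R3) ⇐ `NewLevelIsBirth ∧ OldTermsAreJetsOwn ∧ LambdaFarSmallOwn` — so in the display list of `WHAT-3CHI-IS-PER-RUN-w1g0-v2.md` §4 the
  residual row (R3) is now: (M1)-exact + the Λ-far re-display, everything else being theorems of the core's displayed rows.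
HONEST FRAMING: bookkeeping; nothing of [Balaban1985UV3] / [King1986] asserted; registry untouched; YM₃ on T³ is a rung, not the Clay problem / 𝕋⁴ / a mass gap.

References: T. Bałaban, CMP 102 (1985) 255–275 [Balaban1985UV3] (p.262 L25–27, (25) p.262, (33)–(34) p.264, (43) p.266, (57) p.270, (61)–(63) pp.271–272).
-/

set_option autoImplicit false

noncomputable section

open scoped BigOperators
open Finset
open Literature.MathematicalPhysics.QuantumFieldTheory.Balaban1983to89
open Literature.MathematicalPhysics.QuantumFieldTheory.Balaban1983to89.T3ContinuumYM3Torus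
open Literature.MathematicalPhysics.QuantumFieldTheory.Balaban1983to89.T3UnitScaleTilt
open Literature.MathematicalPhysics.QuantumFieldTheory.Balaban1983to89.T3LevelShift
open Literature.MathematicalPhysics.QuantumFieldTheory.Balaban1983to89.T3AlphaInputsAC
open Literature.MathematicalPhysics.QuantumFieldTheory.Balaban1983to89.T3AlphaPolymerSocket
open Literature.MathematicalPhysics.QuantumFieldTheory.Balaban1983to89.T3AlphaInputsACTwoRun
open Literature.MathematicalPhysics.QuantumFieldTheory.Balaban1983to89.T3AlphaInputsACTwoRunLevel
open Literature.MathematicalPhysics.QuantumFieldTheory.Balaban1983to89.TreeLengthTorus (tsys)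
open Literature.MathematicalPhysics.QuantumFieldTheory.Balaban1985CMP102
open Literature.MathematicalPhysics.QuantumFieldTheory.Balaban1985CMP102.Setting
open Summit.QuantumFields.Balaban3D.Carriers
open Summit.QuantumFields.Balaban3D.Proofs.Primitives
open Summit.QuantumFields.Balaban3D.Proofs.GroupModelLieC (lieC)
open Summit.QuantumFields.Balaban3D.Proofs.Representation33 (jet26)
open Summit.QuantumFields.Balaban3D.Proofs.NewbornJet (tlConst tlConst_nonneg)
open Summit.QuantumFields.YangMills.Theorems
open Summit.QuantumFields.YangMills.Theorems.GlobalSlackKernelMatching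
open Summit.QuantumFields.YangMills.Theorems.GlobalSlackCanonicalPolymers

namespace Summit.QuantumFields.YangMills.Theorems.GlobalSlackKernelLeg

variable {F : T3Family} {𝔠 : AlphaConsts F.L (suGroupModel 2).N} {γ : ℝ} {hγ : 0 < γ} {hγ1 : γ ≤ (min 𝔠.gamma0 1) ^ 2}

/-! ## §1 The one display left: the (61)-born far terms in seventh-order currency -/

/-- **THE (61)-BORN FAR TERMS ARE SEVENTH-ORDER SMALL, PER RUN** (hypothesis schema, never asserted): for `k + 1 ≤ K`, every retained step-`k` domain `X` of run `K` and every field `W`,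
`|far^Λ_X(triv, W)| ≤ C_Λ·e^{−κ·dj X}·θ(K−k−1)⁷` — G3D-07's far row re-displayed with the spare coupling print has (far monomials are `O(e^{−R₁r(g_k)})`, below any power of the coupling).
[cite: Balaban1985UV3, p.262 L25-27, (57) p.270, (61)-(63) pp.271-272] -/
def LambdaFarSmallOwn (q : ∀ K, AlphaInputsT3AC.PkgCoreV3 F 𝔠 γ hγ hγ1 K) (b₀ p₀ κ C_Λ : ℝ) : Prop :=
  ∀ (K k : ℕ), k + 1 ≤ K → ∀ X ∈ newDomsCore q K k (Hist.triv (F.P K) (k + 1)),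
    ∀ W : GaugeField (F.P K) (k + 1) (Matrix.specialUnitaryGroup (Fin 2) ℂ),
      |((q K).𝔄.Λc k).far X (Hist.triv (F.P K) (k + 1)) W| ≤
        C_Λ * Real.exp (-(κ * (tsys 3 (nblkOf (SK F 𝔠 γ hγ hγ1 K) 𝔠.lane.carrier k)).dj X)) * θBal F.L γ b₀ p₀ (K - k - 1) ^ 7

/-! ## §2 The birth far row from the step-chart theorem and the Λ display -/

/-- ★w3's constant of `abs_stepFar_le_theta7`: `Cfar·C25·tlConst(7r₀,1)·((√L)⁻¹(1+log √L)^{p₀})⁷`. [cite: Balaban1985UV3, (25) p.262, (57) p.270] -/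
def stepFarConst (𝔠 : AlphaConsts F.L (suGroupModel 2).N) : ℝ :=
  𝔠.Cfar * 𝔠.C25 * tlConst (7 * 𝔠.r₀) 1 * ((Real.sqrt F.L)⁻¹ * (1 + Real.log (Real.sqrt F.L)) ^ 𝔠.p₀) ^ 7

/-- **THE BIRTH FAR ROW FROM THE Λ DISPLAY** (the 𝔖-half being ★w3's theorem): `LambdaFarSmallOwn q 𝔠.b₀ 𝔠.p₀ 𝔠.κ C_Λ → BirthFarSmallOwn q 𝔠.b₀ 𝔠.p₀ 𝔠.κ (stepFarConst 𝔠 + C_Λ)`.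
[cite: Balaban1985UV3, (57) p.270, p.264 L15-16] -/
theorem birthFarSmallOwn_of_lambda (q : ∀ K, AlphaInputsT3AC.PkgCoreV3 F 𝔠 γ hγ hγ1 K) {C_Λ : ℝ} (h : LambdaFarSmallOwn q 𝔠.b₀ 𝔠.p₀ 𝔠.κ C_Λ) :
    BirthFarSmallOwn q 𝔠.b₀ 𝔠.p₀ 𝔠.κ (stepFarConst 𝔠 + C_Λ) := by
  intro K k hk X hX W
  have h𝔖 := abs_stepFar_le_theta7 q K k hk X (Hist.triv (F.P K) (k + 1)) W
  have hΛ := h K k hk X hX W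
  refine (abs_add_le _ _).trans ?_
  calc |((q K).𝔖 k).far X (Hist.triv (F.P K) (k + 1)) W| + |((q K).𝔄.Λc k).far X (Hist.triv (F.P K) (k + 1)) W|
      ≤ stepFarConst 𝔠 * θBal F.L γ 𝔠.b₀ 𝔠.p₀ (K - k - 1) ^ 7 * Real.exp (-(𝔠.κ * (tsys 3 (nblkOf (SK F 𝔠 γ hγ hγ1 K) 𝔠.lane.carrier k)).dj X)) +
        C_Λ * Real.exp (-(𝔠.κ * (tsys 3 (nblkOf (SK F 𝔠 γ hγ hγ1 K) 𝔠.lane.carrier k)).dj X)) * θBal F.L γ 𝔠.b₀ 𝔠.p₀ (K - k - 1) ^ 7 := add_le_add h𝔖 hΛ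
    _ = (stepFarConst 𝔠 + C_Λ) * Real.exp (-(𝔠.κ * (tsys 3 (nblkOf (SK F 𝔠 γ hγ hγ1 K) 𝔠.lane.carrier k)).dj X)) * θBal F.L γ 𝔠.b₀ 𝔠.p₀ (K - k - 1) ^ 7 := by
        unfold stepFarConst; ring

/-- `0 ≤ stepFarConst 𝔠`. [folklore] -/
theorem stepFarConst_nonneg (𝔠 : AlphaConsts F.L (suGroupModel 2).N) : 0 ≤ stepFarConst 𝔠 := by
  unfold stepFarConst
  have h1 := 𝔠.Cfar_nonneg; have h2 := 𝔠.C25_nonneg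
  have h3 : 0 ≤ tlConst (7 * 𝔠.r₀) 1 := tlConst_nonneg (by linarith [𝔠.one_le_r₀]) one_pos
  have h4 : 0 ≤ (Real.sqrt F.L)⁻¹ * (1 + Real.log (Real.sqrt F.L)) ^ 𝔠.p₀ := by
    have hL1 : (1 : ℝ) ≤ Real.sqrt F.L := by
      rw [show (1 : ℝ) = Real.sqrt 1 by simp]
      exact Real.sqrt_le_sqrt (by exact_mod_cast F.hL.2.le)
    have hlog : 0 ≤ Real.log (Real.sqrt F.L) := Real.log_nonneg hL1
    positivity
  positivity

/-! ## §3 (R3) from (M1)-exact and the Λ display -/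

/-- **THE RESIDUAL ROW (R3) OF THE PER-RUN SOCKETS FROM «NEW LEVEL IS BIRTH» ∧ «OLD TERMS ARE JETS» ∧ THE Λ FAR DISPLAY**, at the core datum.
[cite: Balaban1985UV3, (43) p.266, (57) p.270] -/
theorem remainderSmallOwnΦ_of_jets_lambda (q : ∀ K, AlphaInputsT3AC.PkgCoreV3 F 𝔠 γ hγ hγ1 K) {Φ : ChartFam ↥(lieC (suGroupModel 2)) F} {e : VacFam F}
    {B : CfgFam ↥(lieC (suGroupModel 2)) F} {C_Λ : ℝ} (hCΛ : 0 ≤ C_Λ)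
    (hNew : NewLevelIsBirth q Φ e B) (hOld : OldTermsAreJetsOwn q Φ e B) (hΛ : LambdaFarSmallOwn q 𝔠.b₀ 𝔠.p₀ 𝔠.κ C_Λ) :
    RemainderSmallOwnΦ (AlphaInputsT3AC.dataOfCoreV3 q (canonPolymerCore q)) (residualRemCore q Φ e B) 𝔠.b₀ 𝔠.p₀ 𝔠.κ (stepFarConst 𝔠 + C_Λ) :=
  remainderSmallOwnΦ_of_split q F.hL.2.le hγ (hγ1.trans (sq_min_one_le _ 𝔠.gamma0_pos)) 𝔠.b₀_pos (add_nonneg (stepFarConst_nonneg 𝔠) hCΛ) hNew hOld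
    (birthFarSmallOwn_of_lambda q hΛ)

/-- The same at the χ-record's datum (`q := toCore ∘ p`). [cite: Balaban1985UV3, (43) p.266, (57) p.270] -/
theorem remainderSmallOwnΦ_chi_of_jets_lambda (p : ∀ K, AlphaInputsT3AC.PkgAtV3Chi F 𝔠 γ hγ hγ1 K) {Φ : ChartFam ↥(lieC (suGroupModel 2)) F} {e : VacFam F}
    {B : CfgFam ↥(lieC (suGroupModel 2)) F} {C_Λ : ℝ} (hCΛ : 0 ≤ C_Λ)
    (hNew : NewLevelIsBirth (fun K => (p K).toCore) Φ e B) (hOld : OldTermsAreJetsOwn (fun K => (p K).toCore) Φ e B)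
    (hΛ : LambdaFarSmallOwn (fun K => (p K).toCore) 𝔠.b₀ 𝔠.p₀ 𝔠.κ C_Λ) :
    RemainderSmallOwnΦ (AlphaInputsT3AC.dataOfV3chi p (canonPolymerCore fun K => (p K).toCore)) (residualRemCore (fun K => (p K).toCore) Φ e B)
      𝔠.b₀ 𝔠.p₀ 𝔠.κ (stepFarConst 𝔠 + C_Λ) :=
  remainderSmallOwnΦ_of_jets_lambda (fun K => (p K).toCore) hCΛ hNew hOld hΛ

end Summit.QuantumFields.YangMills.Theorems.GlobalSlackKernelLeg

end
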